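import Summits.Ventures.CertifiedArithmetic.LowPrec.SRCertificatesFP4
import Summits.Ventures.CertifiedArithmetic.LowPrec.SRLimitedBits
import HarnessLib

/-!
# FP4 (E2M1) kernel certificates for limited-randomness SR (P3109 StochasticA/B/C)

HONEST FRAMING: certified error envelopes and provably optimal rounding/accumulation schemes for
low-precision formats under stated cost models; every table by two implementations; no hardware or
vendor claims.

Exact expectations of the 3-term recursive sum of `(−6, 1/2, 1)` (exact sum `−9/2`; exact SR is
unbiased here, `SRCertificatesFP4`) when each step uses `N` random bits, by `decide +kernel`:
with ONE bit, StochasticA gives `E[ŝ₃] = −4` (bias `+1/2`, towards zero), StochasticB and StochasticC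
give `−5` (bias `−1/2`); with TWO bits all three are exactly unbiased on this triple (every pre-rounding
value is a sum of two E2M1 values, so `η·2²` is an integer). The general bounds are
`stochasticA_bias_le` etc. (`|bias| ≤ n·G·2^{-N}`, here `3·2·2^{-N}`).
-/

namespace Summit.Ventures.CertifiedArithmetic.LowPrec.SR.FP4

open Summit.Ventures.CertifiedArithmetic.LowPrec.SR
open Summit.Ventures.CertifiedArithmetic.LowPrec.SR.LimitedBits

/-- One random bit, StochasticA: `E[ŝ₃] = −4` for `(−6, 1/2, 1)` (exact `−9/2`): bias `+1/2` towards
zero. -/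
theorem stochA_one_bit_witness :
    accExpQ e2m1 (probAwayA 1) (seq3 (-6) (1/2) 1) 3 (fun t => t) 0 = -4 := by
  decide +kernel

/-- One random bit, StochasticB: `E[ŝ₃] = −5` (bias `−1/2`). -/
theorem stochB_one_bit_witness :
    accExpQ e2m1 (probAwayB 1) (seq3 (-6) (1/2) 1) 3 (fun t => t) 0 = -5 := by
  decide +kernel

/-- One random bit, StochasticC: `E[ŝ₃] = −5` (bias `−1/2`). -/
theorem stochC_one_bit_witness :
    accExpQ e2m1 (probAwayC 1) (seq3 (-6) (1/2) 1) 3 (fun t => t) 0 = -5 := by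
  decide +kernel

/-- Two random bits: all three modes are exactly unbiased on this triple. -/
theorem two_bit_unbiased_witness :
    accExpQ e2m1 (probAwayA 2) (seq3 (-6) (1/2) 1) 3 (fun t => t) 0 = -9/2
      ∧ accExpQ e2m1 (probAwayB 2) (seq3 (-6) (1/2) 1) 3 (fun t => t) 0 = -9/2
      ∧ accExpQ e2m1 (probAwayC 2) (seq3 (-6) (1/2) 1) 3 (fun t => t) 0 = -9/2 := by
  decide +kernel

/-- The general one-bit StochasticA bound instantiated: `|E[ŝ₃] + 9/2| ≤ 3·(2·2⁻¹) = 3` (the witness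
shows the actual bias is `1/2`). -/
example : |accExpQ e2m1 (probAwayA 1) (seq3 (-6) (1/2) 1) 3 (fun t => t) 0
    - (0 + ∑ i ∈ Finset.range 3, seq3 (-6) (1/2) 1 i)| ≤ (3 : ℕ) * (1 / 2 ^ 1 * 2) :=
  stochasticA_bias_le e2m1 1 (seq3 (-6) (1/2) 1) 3 0 (by decide +kernel) (by decide +kernel)

end Summit.Ventures.CertifiedArithmetic.LowPrec.SR.FP4
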